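import Literature.MathematicalPhysics.QuantumFieldTheory.Balaban1983to89.B16Ineq17LocalFederbushSlice
import Literature.MathematicalPhysics.QuantumFieldTheory.Balaban1983to89.B5AverageCurlStokesV1

/-!
# `Balaban1983to89.B16Ineq17FlatRouteConstants` — [Balaban1989LargeFieldII] (1.7)∕(1.9) p. 358 at flat background, THE CONSTANTS IN THE TREE's RAW
# UNITS: the one-sided (1.7) letter `h17` of the N12∕s1 endpoint (`B15Prop1OneSidedIneq17Edition` :395, γ₀ generic) from a chain of V1
# averages ending at the slice field, with the EXPLICIT `γ₀ = (κ∕2)·(L^d∕(c²L²))^k` — `= κ∕2` in `d = 4` for the `L`-scaled linearised average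

statement-level skeleton of published theorems with citation tags; proofs where landed; nothing here is a claim about
the Yang–Mills mass gap.

T. Bałaban, *Large field renormalization. II*, Commun. Math. Phys. **122** (1989) 355–392 [Balaban1989LargeFieldII], (1.7)–(1.9) p. 358;
[Balaban1989LargeFieldI] Prop. 1 (1.77)–(1.78) p. 194; [Balaban1984PropagatorsI] (1.18) p. 20, (1.21) p. 21; [Federbush1986PhaseCellI]
'Abelian Stability Theorem' (0.12) p. 321.

Cell pub-ymgap, HUMAN RULING D-0062 ∕ D-0149, seat `pub-ymgap-dag-n12-w4` (WIDTH SEAT 4 of DAG node N12 = [B15]; lane word (ε) of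
`pub-ymgap-dag-n12-c` g16: «the constants of `h17`∕`hsm`∕`hγle` at the record in the tree's RAW units»; key K1⁷ stmt-QuantumFields-20542,
helper, count-neutral).  Inputs BY NAME: this seat's `B5AverageCurlStokesV1` (p588510∕p589901: `sum_normSq_oc_chain_le`, the V1
localized Federbush down a chain `Y_i` with `oc Y_{i+1} = c • oc (Q Y_i)`) and `B16Ineq17LocalFederbushSlice` (p586352), n12-c's slice
coordinates (`GaugeSlice`, `ιA`, `castSite`), dag-n12-w2's reading of the flat second variation of `wilsonAction4 = Σ_p (1 − Re Tr U(∂p)∕N)`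
as `(1∕N)Σ_p ‖σ⁰_p‖²_HS` with `σ⁰_p = oc X p.μ p.ν p.src` (`Node00.deriv_deriv_wilsonAction4_expChart_one_eq_norm_sq`, cited for the shape
of the hypothesis `hflat`; not imported).

THE BOOKKEEPING (what `γ₀` the raw units produce).  Per instance of the endpoint the quadratic form is `Qv(X) = ⟪X, D(rGrad(sliceFn f∘ext))(0) X⟫`
for `X ∈ GaugeSlice (pts k Λ) T ℝ³`; the flat route writes `Qv = Q♭ + E_A` with `Q♭ ≥ (κ∕2)·Σ_{q ⊂ T^{(0)}} ζ(q₋)‖oc (Y_0) q‖²` — `Y_0` the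
`ℝ³`-coordinates of the flat linearised minimiser of the `Z`-problem at `X` (U2b), `κ∕2` = (w2's `1∕N` at `N = 2`) × (the HS-norm² of the
chart's differential on a unit coordinate vector, `κ`), `ζ = ζ₀` — and a chain `Y_0, …, Y_k` of V1 fields with `oc Y_{i+1} = c • oc (Q Y_i)`
near `Λ` (the linearised averaging of record: `c = L` by `B5AverageCurlStokesV1.oc_linAvg`) ending at `Y_k` with the plaquette variables of
`ιA X` on the window (U2b's «averages of `H⁰X` reproduce `X`»).  Then §2: `γ₀^{raw}·circ(X) ≤ Q♭` with
`γ₀^{raw} = (κ∕2)·((L^d)^k ∕ (c²L²)^k)`, hence `h17` with that `γ₀` and the (b)-letter's `Cerr`; in `d = 4` with `c = L`, `γ₀^{raw} = κ∕2`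
independently of `k` (§3) — print's «γ₀ … dependent on d only», here `= κ∕2`, and `hsm` reads `Cerr_i ≤ (κ∕2)∕(2(3K_i² + 2K_i⁴))`.

WHAT THIS FILE PROVES (THEOREMS ONLY — no `def`, no `sorry`; axioms standard).
§1 `curl_ιA_castSite_eq_oc_apply` (the `h17` window-circulation summand IS the `a`-coordinate of p22's `oc (ιA X) 0 μ (castSite z)`),
   `circ_eq_sum_normSq_oc` (`circ(X) = Σ_{z∈window} Σ_μ ‖oc (ιA X) 0 μ (castSite z)‖²`), `circ_le_sum_normSq_oc_of_subset` (window → any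
   `S ⊇` its `castSite`-image, no wrapping), `oc_self_eq_zero` (the `μ = 0` plane carries nothing).
§2 ★★ `gamma0_circ_le_of_flat_chain` (`γ₀^{raw}·circ(X) ≤ Q♭`) and ★★ `h17_rawUnits_of_flat_chain` (the `h17` body of
   `B15Prop1OneSidedIneq17Edition` :395 with `γ₀ := (κ∕2)·((L^d)^k∕(c²L²)^k)`).
§3 `gamma0_raw_dim4` (`d = 4`, `c = L`: the factor is `1`), ★ `h17_rawUnits_dim4` (`γ₀ = κ∕2`), `hsm_rawUnits_iff` (the smallness `hsm` at that `γ₀`,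
   unfolded).

HONEST SCOPE.  Units∕constants bookkeeping over landed kernel theorems; `κ`, `c`, the chain `Y_i`, the sets `S_i`, the weight `ζ` and the
splitting `Qv = Q♭ + E_A` are DISPLAYED data∕hypotheses (U2a: w2's flat value and letter (b); U2b: w3's `DΨ(0)∘H = id` read in V1
currency — junction (J-b), not typed here); nothing of Bałaban's asserted; count-neutral; N12 NOT discharged; one finite 𝕋⁴ programme at
fixed `ε`; R4 closes the conditional rung `BalabanLadder.UV` only; nothing continuum ∕ ℝ⁴ ∕ OS ∕ mass gap ∕ Clay.
-/

noncomputable section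

open Set Finset
open scoped BigOperators RealInnerProductSpace

namespace Literature.MathematicalPhysics.QuantumFieldTheory.Balaban1983to89.B16Ineq17FlatRouteConstants

open B15DeterminingSets GaugeField B15Prop1Carrier
open B15Prop1SliceCoordinates (GaugeSlice ιA)
open T4AxialGaugeSmallField (castSite castSite_apply castSite_add_e castSite_injOn_box)
open B7Prop1Explicit (e e_apply)
open B6TreeGaugePoincare (curl)
open B16Eq18Proof (box mem_box)
open LatticeFieldCalculus (bondAvg runSite)
open B6StairStokesTorus (oc)
open B5AverageCurlStokesV1 (sum_normSq_oc_chain_le)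

variable {P : Params} {k : ℕ}

/-! ## §1  The window circulation sum in `oc` currency -/

section Circ

omit k in
/-- The two unit vectors of `ℤ^d` in the tree agree (`B6BondElimination.unitVec μ = B7Prop1Explicit.e μ`). [folklore] -/
private theorem unitVec_eq_e (μ : Fin P.d) : (B6BondElimination.unitVec μ : Fin P.d → ℤ) = e μ := by
  funext i
  rw [B6BondElimination.unitVec_apply, e_apply]

variable [DecidableEq (PBond P k)]

/-- **THE `h17` SUMMAND IS AN `oc` COORDINATE**: for `X ∈ GaugeSlice S T ℝ³`, the `ℤ^d`-pullback plaquette circulation of the `a`-th coordinate field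
of `ιA X` at `(z; j, μ)` is the `a`-th coordinate of p22's ordered plaquette variable `oc (ιA X) j μ (castSite z)` on the torus of `Setup`
(`castSite (z + e_μ) = (castSite z).shift μ`). [cite: Balaban1984PropagatorsI, (1.4) p.18; Balaban1989LargeFieldII, (1.8) p.358] -/
theorem curl_ιA_castSite_eq_oc_apply {S : Set (Site P k)} {T : Finset (PBond P k)} (X : GaugeSlice S T (EuclideanSpace ℝ (Fin 3)))
    (a : Fin 3) (z : Fin P.d → ℤ) (j μ : Fin P.d) :
    curl (fun b => ιA S T X (⟨castSite b.1, b.2⟩ : PBond P k) a) z j μ = (oc (ιA S T X) j μ (castSite z)) a := by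
  simp only [curl, oc, unitVec_eq_e, castSite_add_e, PiLp.add_apply, PiLp.sub_apply]

/-- **THE WINDOW CIRCULATION SUM IN `oc` CURRENCY**: `Σ_{z∈window} Σ_μ Σ_a (∂(ιA X)_a)(z; e₀, e_μ)² = Σ_{z∈window} Σ_μ ‖oc (ιA X) 0 μ (castSite z)‖²`
(`ℝ³` with its Euclidean norm, `EuclideanSpace.real_norm_sq_eq`). [cite: Balaban1989LargeFieldII, (1.7)–(1.8) p.358] -/
theorem circ_eq_sum_normSq_oc (h0 : 0 < P.d) {S : Set (Site P k)} {T : Finset (PBond P k)}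
    (X : GaugeSlice S T (EuclideanSpace ℝ (Fin 3))) (W : Finset (Fin P.d → ℤ)) :
    ∑ z ∈ W, ∑ μ : Fin P.d, ∑ a : Fin 3, curl (fun b => ιA S T X (⟨castSite b.1, b.2⟩ : PBond P k) a) z ⟨0, h0⟩ μ ^ 2
      = ∑ z ∈ W, ∑ μ : Fin P.d, ‖oc (ιA S T X) ⟨0, h0⟩ μ (castSite z)‖ ^ 2 := by
  refine Finset.sum_congr rfl fun z _ => Finset.sum_congr rfl fun μ _ => ?_
  rw [EuclideanSpace.real_norm_sq_eq]
  exact Finset.sum_congr rfl fun a _ => by rw [curl_ιA_castSite_eq_oc_apply]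

omit [DecidableEq (PBond P k)] in
/-- **WINDOW → A SET OF TORUS PLAQUETTES**: for a window `box m lo` without wrapping (`m_κ ≤ sitesPerDir k`, so `castSite` is injective on it) and
any finite set `S₁` of torus sites containing its image, a non-negative function summed over the window's image is at most its sum over `S₁`.
[cite: Balaban1989LargeFieldII, (1.8) p.358] -/
theorem sum_box_castSite_le_sum_of_subset {m : Fin P.d → ℕ} (lo : Fin P.d → ℤ) (hm : ∀ κ, (m κ : ℤ) ≤ P.sitesPerDir k)
    (S₁ : Finset (Site P k)) (hS₁ : ∀ z ∈ box m lo, (castSite z : Site P k) ∈ S₁) (g : Site P k → ℝ) (hg : ∀ x, 0 ≤ g x) :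
    ∑ z ∈ box m lo, g (castSite (j := k) z) ≤ ∑ y ∈ S₁, g y := by
  classical
  have hinj : Set.InjOn (fun z : Fin P.d → ℤ => castSite (P := P) (j := k) z) ↑(box m lo) := by
    intro x hx x' hx' h
    rw [Finset.mem_coe, mem_box] at hx hx'
    refine castSite_injOn_box (j := k) (lo := lo) (hi := fun κ => lo κ + m κ - 1) (fun κ => ?_)
      (fun κ => (hx κ).1) (fun κ => ?_) (fun κ => (hx' κ).1) (fun κ => ?_) h
    · have := hm κ
      show lo κ + (m κ : ℤ) - 1 - lo κ < (P.sitesPerDir k : ℤ)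
      omega
    · have := (hx κ).2
      show x κ ≤ lo κ + (m κ : ℤ) - 1
      omega
    · have := (hx' κ).2
      show x' κ ≤ lo κ + (m κ : ℤ) - 1
      omega
  rw [← Finset.sum_image hinj]
  exact Finset.sum_le_sum_of_subset_of_nonneg (fun y hy => by
    obtain ⟨z, hz, rfl⟩ := Finset.mem_image.mp hy
    exact hS₁ z hz) fun y _ _ => hg y

omit [DecidableEq (PBond P k)] in
/-- The diagonal plane carries no plaquette variable: `oc A μ μ s = 0`. [cite: Balaban1984PropagatorsI, (1.4) p.18] -/
theorem oc_self_eq_zero {V : Type*} [AddCommGroup V] {j : ℕ} (A : VecField P j V) (μ : Fin P.d) (s : Site P j) : oc A μ μ s = 0 := by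
  simp only [oc]
  abel

end Circ

/-! ## §2  The one-sided (1.7) letter with the raw-unit `γ₀` -/

section RawUnits

/-- Plaquette reindexing (re-proof of the private helper of `B5AverageCurlStokesV1`): a sum over the plaquettes of `T^{(j)}` is the sum over
ORDERED direction pairs of the site sums. [folklore] -/
private theorem sum_plaq_eq {j : ℕ} {M : Type*} [AddCommMonoid M] (f : Site P j → Fin P.d → Fin P.d → M) :
    ∑ p : Plaq P j, f p.src p.μ p.ν = ∑ μ : Fin P.d, ∑ ν : Fin P.d, if μ < ν then ∑ x : Site P j, f x μ ν else 0 := by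
  classical
  have hinj : Function.Injective (fun p : Plaq P j => (p.src, p.μ, p.ν)) := by
    rintro ⟨x, μ, ν, h⟩ ⟨x', μ', ν', h'⟩ hpq
    simp only [Prod.mk.injEq] at hpq
    obtain ⟨h1, h2, h3⟩ := hpq
    subst h1; subst h2; subst h3
    rfl
  have himg : (Finset.univ : Finset (Plaq P j)).image (fun p => (p.src, p.μ, p.ν))
      = Finset.univ.filter (fun t : Site P j × Fin P.d × Fin P.d => t.2.1 < t.2.2) := by
    ext t
    simp only [Finset.mem_image, Finset.mem_univ, true_and, Finset.mem_filter]
    constructor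
    · rintro ⟨p, rfl⟩
      exact p.hμν
    · intro ht
      exact ⟨⟨t.1, t.2.1, t.2.2, ht⟩, rfl⟩
  calc ∑ p : Plaq P j, f p.src p.μ p.ν
      = ∑ t ∈ (Finset.univ : Finset (Plaq P j)).image (fun p => (p.src, p.μ, p.ν)), f t.1 t.2.1 t.2.2 := by
        rw [Finset.sum_image fun p _ q _ h => hinj h]
    _ = ∑ t ∈ Finset.univ.filter (fun t : Site P j × Fin P.d × Fin P.d => t.2.1 < t.2.2), f t.1 t.2.1 t.2.2 := by rw [himg]
    _ = ∑ t : Site P j × Fin P.d × Fin P.d, if t.2.1 < t.2.2 then f t.1 t.2.1 t.2.2 else 0 := Finset.sum_filter _ _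
    _ = ∑ x : Site P j, ∑ μ : Fin P.d, ∑ ν : Fin P.d, if μ < ν then f x μ ν else 0 := by
        rw [Fintype.sum_prod_type]
        exact Finset.sum_congr rfl fun x _ => by rw [Fintype.sum_prod_type]
    _ = ∑ μ : Fin P.d, ∑ ν : Fin P.d, if μ < ν then ∑ x : Site P j, f x μ ν else 0 := by
        rw [Finset.sum_comm]
        refine Finset.sum_congr rfl fun μ _ => ?_
        rw [Finset.sum_comm]
        refine Finset.sum_congr rfl fun ν _ => ?_
        by_cases h : μ < ν
        · simp only [if_pos h]
        · simp only [if_neg h, Finset.sum_const_zero]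

/-- **The `0`-th direction planes are among all planes**: for a non-negative plane functional `F`, `Σ_{ν ≠ e₀} F(e₀, ν) ≤ Σ_{μ<ν} F(μ, ν)` in the
plaquette indexing. [folklore] -/
private theorem sum_axis_le_sum_plaq {j : ℕ} (h0 : 0 < P.d) (F : Site P j → Fin P.d → Fin P.d → ℝ) (hF : ∀ x μ ν, 0 ≤ F x μ ν) :
    ∑ ν ∈ Finset.univ.filter (fun ν : Fin P.d => (⟨0, h0⟩ : Fin P.d) ≠ ν), ∑ x : Site P j, F x ⟨0, h0⟩ ν
      ≤ ∑ p : Plaq P j, F p.src p.μ p.ν := by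
  rw [sum_plaq_eq F]
  have hrow : ∑ ν ∈ Finset.univ.filter (fun ν : Fin P.d => (⟨0, h0⟩ : Fin P.d) ≠ ν), ∑ x : Site P j, F x ⟨0, h0⟩ ν
      = ∑ ν : Fin P.d, if (⟨0, h0⟩ : Fin P.d) < ν then ∑ x : Site P j, F x ⟨0, h0⟩ ν else 0 := by
    rw [Finset.sum_filter]
    refine Finset.sum_congr rfl fun ν _ => ?_
    have hiff : (⟨0, h0⟩ : Fin P.d) ≠ ν ↔ (⟨0, h0⟩ : Fin P.d) < ν := by
      constructor
      · intro h
        exact lt_of_le_of_ne (Fin.mk_le_of_le_val (Nat.zero_le _)) h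
      · exact fun h => ne_of_lt h
    by_cases h : (⟨0, h0⟩ : Fin P.d) < ν
    · rw [if_pos (hiff.mpr h), if_pos h]
    · rw [if_neg (fun h' => h (hiff.mp h')), if_neg h]
  rw [hrow]
  have hnn : ∀ μ : Fin P.d, 0 ≤ ∑ ν : Fin P.d, if μ < ν then ∑ x : Site P j, F x μ ν else 0 := fun μ =>
    Finset.sum_nonneg fun ν _ => by
      by_cases h : μ < ν
      · rw [if_pos h]; exact Finset.sum_nonneg fun x _ => hF x μ ν
      · rw [if_neg h]
  exact Finset.single_le_sum (f := fun μ : Fin P.d => ∑ ν : Fin P.d, if μ < ν then ∑ x : Site P j, F x μ ν else 0)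
    (fun μ _ => hnn μ) (Finset.mem_univ (⟨0, h0⟩ : Fin P.d))

variable [DecidableEq (PBond P k)]

/-- ★★ **`γ₀^{raw}·circ(X) ≤ Q♭`** — the flat leading form dominates the window circulation sum with the EXPLICIT raw-unit constant.  DATA (displayed):
`X ∈ GaugeSlice S T ℝ³`; a window `box m lo` without wrapping; a chain of `ℝ³`-valued V1 fields `Y_0, …, Y_k` (`k ≤ m + K`) whose top member has
the plaquette variables of `ιA X` on a set `S_k ⊇` the window's image in every axial plane `(e₀, e_ν)`, with `oc Y_{i+1} = c • oc (Q Y_i)` on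
`S_{i+1}` and the stencils of `S_{i+1}` inside `S_i` (U2b: the linearised `Z`-minimiser and the linearised averaging of record, `c = L` by
`B5AverageCurlStokesV1.oc_linAvg`); a fine weight `ζ ≥ 0`, `≥ 1` on `S_0` (`ζ₀ ≡ 1` near `Λ`); and the flat form dominating
`(κ∕2)·Σ_{q ⊂ T^{(0)}} ζ(q₋)‖oc (Y_0) q‖²` (U2a: w2's `(1∕N)Σ_p‖σ⁰_p‖²_HS` at `N = 2`, `κ` = HS-norm² of the chart differential per unit coordinate
vector).  THEN `(κ∕2)·((L^d)^k∕(c²L²)^k)·circ(X) ≤ Q♭`. [cite: Balaban1989LargeFieldII, (1.7) pp.357–358; Federbush1986PhaseCellI, 'Abelian Stability Theorem' (0.12) p.321;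
Balaban1984PropagatorsI, (1.18) p.20, (1.21) p.21] -/
theorem gamma0_circ_le_of_flat_chain (h0 : 0 < P.d) (hk : k ≤ P.m + P.K) {S : Set (Site P k)} {T : Finset (PBond P k)}
    (X : GaugeSlice S T (EuclideanSpace ℝ (Fin 3))) {m : Fin P.d → ℕ} (lo : Fin P.d → ℤ) (hm : ∀ κ, (m κ : ℤ) ≤ P.sitesPerDir k)
    {c κq : ℝ} (hc : c ≠ 0) (hκ : 0 < κq)
    (Y : (i : ℕ) → VecField P i (EuclideanSpace ℝ (Fin 3))) (Sset : (i : ℕ) → Finset (Site P i))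
    (hwin : ∀ z ∈ box m lo, (castSite z : Site P k) ∈ Sset k)
    (hYk : ∀ (ν : Fin P.d), ∀ y ∈ Sset k, oc (Y k) ⟨0, h0⟩ ν y = oc (ιA S T X) ⟨0, h0⟩ ν y)
    (hS : ∀ (ν : Fin P.d), (⟨0, h0⟩ : Fin P.d) ≠ ν → ∀ i, i < k → ∀ y ∈ Sset (i + 1), ∀ (r : Fin P.d → Fin P.L) (s t : ℕ),
      s < P.L → t < P.L → runSite (runSite (Site.blockSite y r) ⟨0, h0⟩ s) ν t ∈ Sset i)
    (hY : ∀ (ν : Fin P.d), (⟨0, h0⟩ : Fin P.d) ≠ ν → ∀ i, i < k → ∀ y ∈ Sset (i + 1),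
      oc (Y (i + 1)) ⟨0, h0⟩ ν y = c • oc (bondAvg (Y i)) ⟨0, h0⟩ ν y)
    (ζ : Site P 0 → ℝ) (hζ0 : ∀ x, 0 ≤ ζ x) (hζ1 : ∀ x ∈ Sset 0, 1 ≤ ζ x) {Qflat : ℝ}
    (hflat : κq / 2 * ∑ q : Plaq P 0, ζ q.src * ‖oc (Y 0) q.μ q.ν q.src‖ ^ 2 ≤ Qflat) :
    κq / 2 * (((P.L : ℝ) ^ P.d) ^ k / (c ^ 2 * (P.L : ℝ) ^ 2) ^ k) *
        ∑ z ∈ box m lo, ∑ μ : Fin P.d, ∑ a : Fin 3, curl (fun b => ιA S T X (⟨castSite b.1, b.2⟩ : PBond P k) a) z ⟨0, h0⟩ μ ^ 2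
      ≤ Qflat := by
  classical
  have hL : (0 : ℝ) < P.L := by exact_mod_cast P.L_pos
  have hcL : (0 : ℝ) < (c ^ 2 * (P.L : ℝ) ^ 2) ^ k := by positivity
  -- Step 1: the circulation sum in `oc` currency, moved to `S_k`, the diagonal plane dropped, and `Y_k` substituted
  set G : Fin P.d → ℝ := fun ν => ∑ y ∈ Sset k, ‖oc (Y k) ⟨0, h0⟩ ν y‖ ^ 2 with hG
  have hcirc : ∑ z ∈ box m lo, ∑ μ : Fin P.d, ∑ a : Fin 3,
        curl (fun b => ιA S T X (⟨castSite b.1, b.2⟩ : PBond P k) a) z ⟨0, h0⟩ μ ^ 2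
      ≤ ∑ ν ∈ Finset.univ.filter (fun ν : Fin P.d => (⟨0, h0⟩ : Fin P.d) ≠ ν), G ν := by
    rw [circ_eq_sum_normSq_oc h0 X (box m lo), Finset.sum_comm]
    -- per plane
    have hplane : ∀ ν : Fin P.d, ∑ z ∈ box m lo, ‖oc (ιA S T X) ⟨0, h0⟩ ν (castSite z)‖ ^ 2 ≤ G ν := by
      intro ν
      refine (sum_box_castSite_le_sum_of_subset lo hm (Sset k) hwin (fun y => ‖oc (ιA S T X) ⟨0, h0⟩ ν y‖ ^ 2)
        fun y => by positivity).trans (le_of_eq ?_)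
      exact Finset.sum_congr rfl fun y hy => by rw [hYk ν y hy]
    have hdiag : G ⟨0, h0⟩ = 0 := by
      simp only [hG]
      exact Finset.sum_eq_zero fun y _ => by rw [oc_self_eq_zero, norm_zero]; simp
    calc ∑ ν : Fin P.d, ∑ z ∈ box m lo, ‖oc (ιA S T X) ⟨0, h0⟩ ν (castSite z)‖ ^ 2
        ≤ ∑ ν : Fin P.d, G ν := Finset.sum_le_sum fun ν _ => hplane ν
      _ = ∑ ν ∈ Finset.univ.filter (fun ν : Fin P.d => (⟨0, h0⟩ : Fin P.d) ≠ ν), G ν := by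
          rw [← Finset.sum_filter_add_sum_filter_not Finset.univ (fun ν : Fin P.d => (⟨0, h0⟩ : Fin P.d) ≠ ν)]
          have hrest : ∑ ν ∈ Finset.univ.filter (fun ν : Fin P.d => ¬ (⟨0, h0⟩ : Fin P.d) ≠ ν), G ν = 0 :=
            Finset.sum_eq_zero fun ν hν => by
              have : ν = ⟨0, h0⟩ := (not_not.mp (Finset.mem_filter.mp hν).2).symm
              rw [this, hdiag]
          rw [hrest, add_zero]
  -- Step 2: the chain estimate per axial plane, summed
  have hchain : ∀ ν : Fin P.d, (⟨0, h0⟩ : Fin P.d) ≠ ν →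
      ((P.L : ℝ) ^ P.d) ^ k * G ν ≤ (c ^ 2 * (P.L : ℝ) ^ 2) ^ k * ∑ x : Site P 0, ζ x * ‖oc (Y 0) ⟨0, h0⟩ ν x‖ ^ 2 := by
    intro ν hν
    refine (sum_normSq_oc_chain_le k hk c Y hν Sset (hS ν hν) (hY ν hν)).trans (mul_le_mul_of_nonneg_left ?_ hcL.le)
    calc ∑ x ∈ Sset 0, ‖oc (Y 0) ⟨0, h0⟩ ν x‖ ^ 2 ≤ ∑ x ∈ Sset 0, ζ x * ‖oc (Y 0) ⟨0, h0⟩ ν x‖ ^ 2 :=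
          Finset.sum_le_sum fun x hx => le_mul_of_one_le_left (by positivity) (hζ1 x hx)
      _ ≤ ∑ x, ζ x * ‖oc (Y 0) ⟨0, h0⟩ ν x‖ ^ 2 :=
          Finset.sum_le_sum_of_subset_of_nonneg (Finset.subset_univ _) fun x _ _ => mul_nonneg (hζ0 x) (by positivity)
  have hsum : ((P.L : ℝ) ^ P.d) ^ k * ∑ ν ∈ Finset.univ.filter (fun ν : Fin P.d => (⟨0, h0⟩ : Fin P.d) ≠ ν), G ν
      ≤ (c ^ 2 * (P.L : ℝ) ^ 2) ^ k * ∑ q : Plaq P 0, ζ q.src * ‖oc (Y 0) q.μ q.ν q.src‖ ^ 2 := by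
    rw [Finset.mul_sum]
    refine (Finset.sum_le_sum fun ν hν => hchain ν (Finset.mem_filter.mp hν).2).trans ?_
    rw [← Finset.mul_sum]
    refine mul_le_mul_of_nonneg_left ?_ hcL.le
    exact sum_axis_le_sum_plaq h0 (fun x μ ν => ζ x * ‖oc (Y 0) μ ν x‖ ^ 2) fun x μ ν => mul_nonneg (hζ0 x) (by positivity)
  -- Step 3: arithmetic
  have hLd : (0 : ℝ) < ((P.L : ℝ) ^ P.d) ^ k := by positivity
  have key : ((P.L : ℝ) ^ P.d) ^ k / (c ^ 2 * (P.L : ℝ) ^ 2) ^ k *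
      ∑ ν ∈ Finset.univ.filter (fun ν : Fin P.d => (⟨0, h0⟩ : Fin P.d) ≠ ν), G ν
      ≤ ∑ q : Plaq P 0, ζ q.src * ‖oc (Y 0) q.μ q.ν q.src‖ ^ 2 := by
    rw [div_mul_eq_mul_div, div_le_iff₀ hcL, mul_comm (∑ q : Plaq P 0, _)]
    simpa [mul_comm] using hsum
  calc κq / 2 * (((P.L : ℝ) ^ P.d) ^ k / (c ^ 2 * (P.L : ℝ) ^ 2) ^ k) *
        ∑ z ∈ box m lo, ∑ μ : Fin P.d, ∑ a : Fin 3, curl (fun b => ιA S T X (⟨castSite b.1, b.2⟩ : PBond P k) a) z ⟨0, h0⟩ μ ^ 2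
      ≤ κq / 2 * (((P.L : ℝ) ^ P.d) ^ k / (c ^ 2 * (P.L : ℝ) ^ 2) ^ k *
          ∑ ν ∈ Finset.univ.filter (fun ν : Fin P.d => (⟨0, h0⟩ : Fin P.d) ≠ ν), G ν) := by
        rw [mul_assoc]
        exact mul_le_mul_of_nonneg_left (mul_le_mul_of_nonneg_left hcirc (by positivity)) (by positivity)
    _ ≤ κq / 2 * ∑ q : Plaq P 0, ζ q.src * ‖oc (Y 0) q.μ q.ν q.src‖ ^ 2 := mul_le_mul_of_nonneg_left key (by positivity)
    _ ≤ Qflat := hflat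

/-- ★★ **THE ONE-SIDED (1.7) LETTER OF `B15Prop1OneSidedIneq17Edition` :395 WITH THE RAW-UNIT `γ₀`**: under the data of
`gamma0_circ_le_of_flat_chain` and the splitting `Qv = Q♭ + E_A` with letter (b) `|E_A| ≤ Cerr·‖X‖²` (dag-n12-w2's
`Node00.abs_deriv_deriv_wilsonAction4_expChart_sub_flat_le_local` shape), for ANY real `Qv` (the consumer's `⟪X, D(rGrad(sliceFn f ∘ ext))(0) X⟫`):
`γ₀·circ(X) − Cerr·‖X‖² ≤ Qv` with `γ₀ = (κ∕2)·((L^d)^k∕(c²L²)^k)`. [cite: Balaban1989LargeFieldII, (1.7) pp.357–358; Balaban1989LargeFieldI, Prop. 1 (1.77)–(1.78) p.194] -/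
theorem h17_rawUnits_of_flat_chain (h0 : 0 < P.d) (hk : k ≤ P.m + P.K) {S : Set (Site P k)} {T : Finset (PBond P k)}
    (X : GaugeSlice S T (EuclideanSpace ℝ (Fin 3))) {m : Fin P.d → ℕ} (lo : Fin P.d → ℤ) (hm : ∀ κ, (m κ : ℤ) ≤ P.sitesPerDir k)
    {c κq : ℝ} (hc : c ≠ 0) (hκ : 0 < κq)
    (Y : (i : ℕ) → VecField P i (EuclideanSpace ℝ (Fin 3))) (Sset : (i : ℕ) → Finset (Site P i))
    (hwin : ∀ z ∈ box m lo, (castSite z : Site P k) ∈ Sset k)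
    (hYk : ∀ (ν : Fin P.d), ∀ y ∈ Sset k, oc (Y k) ⟨0, h0⟩ ν y = oc (ιA S T X) ⟨0, h0⟩ ν y)
    (hS : ∀ (ν : Fin P.d), (⟨0, h0⟩ : Fin P.d) ≠ ν → ∀ i, i < k → ∀ y ∈ Sset (i + 1), ∀ (r : Fin P.d → Fin P.L) (s t : ℕ),
      s < P.L → t < P.L → runSite (runSite (Site.blockSite y r) ⟨0, h0⟩ s) ν t ∈ Sset i)
    (hY : ∀ (ν : Fin P.d), (⟨0, h0⟩ : Fin P.d) ≠ ν → ∀ i, i < k → ∀ y ∈ Sset (i + 1),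
      oc (Y (i + 1)) ⟨0, h0⟩ ν y = c • oc (bondAvg (Y i)) ⟨0, h0⟩ ν y)
    (ζ : Site P 0 → ℝ) (hζ0 : ∀ x, 0 ≤ ζ x) (hζ1 : ∀ x ∈ Sset 0, 1 ≤ ζ x) {Qv Qflat EA Cerr : ℝ} (hQ : Qv = Qflat + EA)
    (hflat : κq / 2 * ∑ q : Plaq P 0, ζ q.src * ‖oc (Y 0) q.μ q.ν q.src‖ ^ 2 ≤ Qflat) (hEA : |EA| ≤ Cerr * ‖X‖ ^ 2) :
    κq / 2 * (((P.L : ℝ) ^ P.d) ^ k / (c ^ 2 * (P.L : ℝ) ^ 2) ^ k) *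
        (∑ z ∈ box m lo, ∑ μ : Fin P.d, ∑ a : Fin 3, curl (fun b => ιA S T X (⟨castSite b.1, b.2⟩ : PBond P k) a) z ⟨0, h0⟩ μ ^ 2)
      - Cerr * ‖X‖ ^ 2 ≤ Qv := by
  have h1 := gamma0_circ_le_of_flat_chain h0 hk X lo hm hc hκ Y Sset hwin hYk hS hY ζ hζ0 hζ1 hflat
  have h2 := (abs_le.mp hEA).1
  rw [hQ]
  linarith

end RawUnits

/-! ## §3  Four dimensions, `L`-scaled linearised average: `γ₀ = κ∕2` -/

section DimFour

/-- **In `d = 4` with the `L`-scaled linearised average (`c = L`, `B5AverageCurlStokesV1.oc_linAvg`) the raw-unit factor is `1`**: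
`((L^4)^k)∕((L²·L²)^k) = 1` — the marginal dimension: the flat (1.7) constant does not depend on the number of steps `k`.
[cite: Balaban1989LargeFieldII, (1.7) p.358; Federbush1986PhaseCellI, (1.8)–(1.9) p.323 («In d dimensions … a factor N^{4−d}»)] -/
theorem gamma0_raw_dim4 (hd : P.d = 4) (k : ℕ) :
    ((P.L : ℝ) ^ P.d) ^ k / (((P.L : ℝ)) ^ 2 * (P.L : ℝ) ^ 2) ^ k = 1 := by
  have hL : (P.L : ℝ) ≠ 0 := by exact_mod_cast P.L_pos.ne'
  rw [hd, show ((P.L : ℝ)) ^ 2 * (P.L : ℝ) ^ 2 = (P.L : ℝ) ^ 4 by ring, div_self (pow_ne_zero _ (pow_ne_zero _ hL))]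

variable [DecidableEq (PBond P k)]

/-- ★ **`h17` IN FOUR DIMENSIONS: `γ₀ = κ∕2`**.  With `d = 4` and `c = L` the raw-unit `γ₀` of `h17_rawUnits_of_flat_chain` is `κ∕2`, for every `k`
(so the smallness `hsm : Cerr_i ≤ γ₀∕(2(3K_i² + 2K_i⁴))` of the one-sided edition reads `Cerr_i ≤ (κ∕2)∕(2(3K_i² + 2K_i⁴))`).
[cite: Balaban1989LargeFieldII, (1.7)–(1.9) p.358; Balaban1989LargeFieldI, Prop. 1 (1.77)–(1.78) p.194] -/
theorem h17_rawUnits_dim4 (hd : P.d = 4) (h0 : 0 < P.d) (hk : k ≤ P.m + P.K) {S : Set (Site P k)} {T : Finset (PBond P k)}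
    (X : GaugeSlice S T (EuclideanSpace ℝ (Fin 3))) {m : Fin P.d → ℕ} (lo : Fin P.d → ℤ) (hm : ∀ κ, (m κ : ℤ) ≤ P.sitesPerDir k)
    {κq : ℝ} (hκ : 0 < κq)
    (Y : (i : ℕ) → VecField P i (EuclideanSpace ℝ (Fin 3))) (Sset : (i : ℕ) → Finset (Site P i))
    (hwin : ∀ z ∈ box m lo, (castSite z : Site P k) ∈ Sset k)
    (hYk : ∀ (ν : Fin P.d), ∀ y ∈ Sset k, oc (Y k) ⟨0, h0⟩ ν y = oc (ιA S T X) ⟨0, h0⟩ ν y)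
    (hS : ∀ (ν : Fin P.d), (⟨0, h0⟩ : Fin P.d) ≠ ν → ∀ i, i < k → ∀ y ∈ Sset (i + 1), ∀ (r : Fin P.d → Fin P.L) (s t : ℕ),
      s < P.L → t < P.L → runSite (runSite (Site.blockSite y r) ⟨0, h0⟩ s) ν t ∈ Sset i)
    (hY : ∀ (ν : Fin P.d), (⟨0, h0⟩ : Fin P.d) ≠ ν → ∀ i, i < k → ∀ y ∈ Sset (i + 1),
      oc (Y (i + 1)) ⟨0, h0⟩ ν y = (P.L : ℝ) • oc (bondAvg (Y i)) ⟨0, h0⟩ ν y)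
    (ζ : Site P 0 → ℝ) (hζ0 : ∀ x, 0 ≤ ζ x) (hζ1 : ∀ x ∈ Sset 0, 1 ≤ ζ x) {Qv Qflat EA Cerr : ℝ} (hQ : Qv = Qflat + EA)
    (hflat : κq / 2 * ∑ q : Plaq P 0, ζ q.src * ‖oc (Y 0) q.μ q.ν q.src‖ ^ 2 ≤ Qflat) (hEA : |EA| ≤ Cerr * ‖X‖ ^ 2) :
    κq / 2 * (∑ z ∈ box m lo, ∑ μ : Fin P.d, ∑ a : Fin 3, curl (fun b => ιA S T X (⟨castSite b.1, b.2⟩ : PBond P k) a) z ⟨0, h0⟩ μ ^ 2)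
      - Cerr * ‖X‖ ^ 2 ≤ Qv := by
  have hL : (P.L : ℝ) ≠ 0 := by exact_mod_cast P.L_pos.ne'
  have h := h17_rawUnits_of_flat_chain h0 hk X lo hm hL hκ Y Sset hwin hYk hS hY ζ hζ0 hζ1 hQ hflat hEA
  rwa [gamma0_raw_dim4 hd k, mul_one] at h

/-- **The smallness `hsm` at the raw-unit `γ₀`, unfolded**: `Cerr ≤ (κ∕2)∕(2(3K² + 2K⁴)) ↔ 4·Cerr·(3K² + 2K⁴) ≤ κ` (`K ≥ 1` the window side bound of
the one-sided edition) — the condition the run's `ε_k` must meet through the (b)-letter's `Cerr = O(1)·M⁶R_kε_k`.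
[cite: Balaban1989LargeFieldII, (1.9) p.358 («for g_k sufficiently small»)] -/
theorem hsm_rawUnits_iff {κq Cerr : ℝ} {K : ℕ} (hK : 1 ≤ K) :
    Cerr ≤ κq / 2 / (2 * (3 * (K : ℝ) ^ 2 + 2 * (K : ℝ) ^ 4)) ↔ 4 * Cerr * (3 * (K : ℝ) ^ 2 + 2 * (K : ℝ) ^ 4) ≤ κq := by
  have hK' : (1 : ℝ) ≤ K := by exact_mod_cast hK
  have hpos : (0 : ℝ) < 2 * (3 * (K : ℝ) ^ 2 + 2 * (K : ℝ) ^ 4) := by positivity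
  rw [le_div_iff₀ hpos, le_div_iff₀ (by norm_num : (0 : ℝ) < 2)]
  constructor <;> intro h <;> linarith

end DimFour

/-! ## v1.1 — the chain estimate WITHOUT the reproduction hypothesis -/

section ChainOnly

/-- ★★ **THE LOCALIZED WEIGHTED FEDERBUSH CHAIN FOR AN ARBITRARY CHAIN (no slice vector, no reproduction)** — Steps 2–3 of `gamma0_circ_le_of_flat_chain` in isolation:
`((L^d)^k ∕ (c²L²)^k) · Σ_{ν ≠ e₀} Σ_{y ∈ S_k} ‖oc (Y k) e₀ ν y‖² ≤ Σ_q ζ(q.src)·‖oc (Y 0) q‖²` — the weighted flat fine curl energy dominates the TOP MEMBER's own axial-plane circulation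
energy on `S_k` (first step of a velocity-form `hm`). [cite: Federbush1986PhaseCellI, 'Abelian Stability Theorem' (0.12) p.321, (1.3)–(1.9) pp.322–323; Balaban1989LargeFieldII, (1.7) p.358] -/
theorem sum_normSq_oc_top_le_weighted_of_flat_chain (h0 : 0 < P.d) (hk : k ≤ P.m + P.K) {c : ℝ} (hc : c ≠ 0)
    (Y : (i : ℕ) → VecField P i (EuclideanSpace ℝ (Fin 3))) (Sset : (i : ℕ) → Finset (Site P i))
    (hS : ∀ (ν : Fin P.d), (⟨0, h0⟩ : Fin P.d) ≠ ν → ∀ i, i < k → ∀ y ∈ Sset (i + 1), ∀ (r : Fin P.d → Fin P.L) (s t : ℕ),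
      s < P.L → t < P.L → runSite (runSite (Site.blockSite y r) ⟨0, h0⟩ s) ν t ∈ Sset i)
    (hY : ∀ (ν : Fin P.d), (⟨0, h0⟩ : Fin P.d) ≠ ν → ∀ i, i < k → ∀ y ∈ Sset (i + 1),
      oc (Y (i + 1)) ⟨0, h0⟩ ν y = c • oc (bondAvg (Y i)) ⟨0, h0⟩ ν y)
    (ζ : Site P 0 → ℝ) (hζ0 : ∀ x, 0 ≤ ζ x) (hζ1 : ∀ x ∈ Sset 0, 1 ≤ ζ x) :
    ((P.L : ℝ) ^ P.d) ^ k / (c ^ 2 * (P.L : ℝ) ^ 2) ^ k *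
        ∑ ν ∈ Finset.univ.filter (fun ν : Fin P.d => (⟨0, h0⟩ : Fin P.d) ≠ ν), ∑ y ∈ Sset k, ‖oc (Y k) ⟨0, h0⟩ ν y‖ ^ 2
      ≤ ∑ q : Plaq P 0, ζ q.src * ‖oc (Y 0) q.μ q.ν q.src‖ ^ 2 := by
  classical
  have hL : (0 : ℝ) < P.L := by exact_mod_cast P.L_pos
  have hcL : (0 : ℝ) < (c ^ 2 * (P.L : ℝ) ^ 2) ^ k := by positivity
  have hchain : ∀ ν : Fin P.d, (⟨0, h0⟩ : Fin P.d) ≠ ν →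
      ((P.L : ℝ) ^ P.d) ^ k * ∑ y ∈ Sset k, ‖oc (Y k) ⟨0, h0⟩ ν y‖ ^ 2 ≤ (c ^ 2 * (P.L : ℝ) ^ 2) ^ k * ∑ x : Site P 0, ζ x * ‖oc (Y 0) ⟨0, h0⟩ ν x‖ ^ 2 := by
    intro ν hν
    refine (sum_normSq_oc_chain_le k hk c Y hν Sset (hS ν hν) (hY ν hν)).trans (mul_le_mul_of_nonneg_left ?_ hcL.le)
    calc ∑ x ∈ Sset 0, ‖oc (Y 0) ⟨0, h0⟩ ν x‖ ^ 2 ≤ ∑ x ∈ Sset 0, ζ x * ‖oc (Y 0) ⟨0, h0⟩ ν x‖ ^ 2 :=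
          Finset.sum_le_sum fun x hx => le_mul_of_one_le_left (by positivity) (hζ1 x hx)
      _ ≤ ∑ x, ζ x * ‖oc (Y 0) ⟨0, h0⟩ ν x‖ ^ 2 :=
          Finset.sum_le_sum_of_subset_of_nonneg (Finset.subset_univ _) fun x _ _ => mul_nonneg (hζ0 x) (by positivity)
  have hsum : ((P.L : ℝ) ^ P.d) ^ k * ∑ ν ∈ Finset.univ.filter (fun ν : Fin P.d => (⟨0, h0⟩ : Fin P.d) ≠ ν), ∑ y ∈ Sset k, ‖oc (Y k) ⟨0, h0⟩ ν y‖ ^ 2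
      ≤ (c ^ 2 * (P.L : ℝ) ^ 2) ^ k * ∑ q : Plaq P 0, ζ q.src * ‖oc (Y 0) q.μ q.ν q.src‖ ^ 2 := by
    rw [Finset.mul_sum]
    refine (Finset.sum_le_sum fun ν hν => hchain ν (Finset.mem_filter.mp hν).2).trans ?_
    rw [← Finset.mul_sum]
    refine mul_le_mul_of_nonneg_left ?_ hcL.le
    exact sum_axis_le_sum_plaq h0 (fun x μ ν => ζ x * ‖oc (Y 0) μ ν x‖ ^ 2) fun x μ ν => mul_nonneg (hζ0 x) (by positivity)
  rw [div_mul_eq_mul_div, div_le_iff₀ hcL, mul_comm (∑ q : Plaq P 0, _)]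
  simpa [mul_comm] using hsum

end ChainOnly

end Literature.MathematicalPhysics.QuantumFieldTheory.Balaban1983to89.B16Ineq17FlatRouteConstants

end
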